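import Summits.ResolutionOfSingularities.ResolutionOfSingularities.Theorems.FrobeniusClosingSteerBetaPolygonMoves
import HarnessLib

/-!
# Crux `Steer` (stmt-ResolutionOfSingularities-16345), chain W4.1, β-LEAF, K-β2♭ part (II), file 11: the face word `DeltaFaceGe`
# is invariant under INTEGRAL FACE MOVES `z ↦ z + l₁ x^a y^b`, `w ↦ w + l₂ x^a y^b` at `(δ, γ) = (a + b, b)` (def-free)

OURS (campaign `res-hironaka`, rung L ★L-G4, slot W4.1; statements about the route's own objects; they replace the
role of no printed item and are NOT statements of the manuscript under review [claim: Hironaka2017, status: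
under-review]; AI review is weaker than expert review). Seat res-D-pv-003 (gen 7), K-β2♭ kernel owner — (II-X) C′ (`c = 0`).

res-L0-w41-stub-4's move engine (`…BetaPolygonFiltration`: `sup_iSup_eq_of_move` for a MULTIPLICATIVE filtration `C` with
`C 0 = ⊤` and moves in `C 1`) applied to the FACE CELLS `C(m) = (x, y)^((a+b)m + 1) + y^(bm) · (x, y)^(am)` of the word
`DeltaFaceGe x y z w d (a + b) b`: the cells are multiplicative and the monomial `x^a y^b` of the integral face end `w⁻ = (a, b)` lies
in `C 1`, so the word does not change under the dissolving moves of `IsFaceDissolvableTwAt`.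

* `faceCell_zero`, `faceCell_mul_le`, `monomial_mem_faceCell_one` — the filtration properties.
* **`deltaFaceGe_faceMove_iff`** — `DeltaFaceGe x y (z + l₁ x^a y^b) (w + l₂ x^a y^b) d (a + b) b f ↔ DeltaFaceGe x y z w d (a + b) b f`.

[cite: CossartJannsenSaito2020, Lemma 12.1 (4)] No Theses file is imported; nothing here is a route item or a registration.
-/

noncomputable section

-- `Summit.<S>.<S>.…` duplicates the summit name by design (single-problem summit).
set_option linter.dupNamespace false

namespace Summit.ResolutionOfSingularities.ResolutionOfSingularities.Theorems.SwitchingDichotomy.BetaNewton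

open IsLocalRing
open Summit.ResolutionOfSingularities.ResolutionOfSingularities.Theorems.SwitchingDichotomy.BetaPolygon
open Summit.ResolutionOfSingularities.ResolutionOfSingularities.Theorems.SwitchingDichotomy.BetaPolygonMoves (sup_iSup_eq_of_move)

variable {S : Type} [CommRing S]

/-- Floor of an integral product. [folklore] -/
theorem floor_natCast_mul_natCast (c n : ℕ) : ⌊(c : ℚ) * (n : ℚ)⌋₊ = c * n := by
  rw [show (c : ℚ) * (n : ℚ) = ((c * n : ℕ) : ℚ) by push_cast; ring, Nat.floor_natCast]

/-- Ceiling of an integral product. [folklore] -/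
theorem ceil_natCast_mul_natCast (c n : ℕ) : ⌈(c : ℚ) * (n : ℚ)⌉₊ = c * n := by
  rw [show (c : ℚ) * (n : ℚ) = ((c * n : ℕ) : ℚ) by push_cast; ring, Nat.ceil_natCast]

/-- The FACE CELL of the integral face end `(a, b)` in slot `n`: `(x, y)^((a+b)n + 1) + y^(bn) · (x, y)^(an)`, written with the
floors and ceilings of the word `DeltaFaceGe … ((a + b : ℕ) : ℚ) (b : ℚ)`, equals that monomial form. [folklore] -/
theorem faceCell_eq (x y : S) (a b n : ℕ) :
    Ideal.span ({x, y} : Set S) ^ (⌊((a + b : ℕ) : ℚ) * (n : ℚ)⌋₊ + 1) ⊔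
        Ideal.span {y ^ ⌈(b : ℚ) * (n : ℚ)⌉₊} *
          Ideal.span ({x, y} : Set S) ^ (⌈((a + b : ℕ) : ℚ) * (n : ℚ)⌉₊ - ⌈(b : ℚ) * (n : ℚ)⌉₊) =
      Ideal.span ({x, y} : Set S) ^ ((a + b) * n + 1) ⊔ Ideal.span {y ^ (b * n)} * Ideal.span ({x, y} : Set S) ^ (a * n) := by
  rw [floor_natCast_mul_natCast, ceil_natCast_mul_natCast, ceil_natCast_mul_natCast,
    show (a + b) * n - b * n = a * n by rw [Nat.add_mul, Nat.add_sub_cancel]]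

/-- The zeroth face cell is everything. [folklore] -/
theorem faceCell_zero (x y : S) (a b : ℕ) :
    Ideal.span ({x, y} : Set S) ^ (⌊((a + b : ℕ) : ℚ) * ((0 : ℕ) : ℚ)⌋₊ + 1) ⊔
        Ideal.span {y ^ ⌈(b : ℚ) * ((0 : ℕ) : ℚ)⌉₊} *
          Ideal.span ({x, y} : Set S) ^ (⌈((a + b : ℕ) : ℚ) * ((0 : ℕ) : ℚ)⌉₊ - ⌈(b : ℚ) * ((0 : ℕ) : ℚ)⌉₊) = ⊤ := by
  rw [faceCell_eq]
  simp

/-- **The face cells are multiplicative**: `C(n) · C(n') ≤ C(n + n')`. [folklore] -/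
theorem faceCell_mul_le (x y : S) (a b n n' : ℕ) :
    (Ideal.span ({x, y} : Set S) ^ (⌊((a + b : ℕ) : ℚ) * (n : ℚ)⌋₊ + 1) ⊔
        Ideal.span {y ^ ⌈(b : ℚ) * (n : ℚ)⌉₊} *
          Ideal.span ({x, y} : Set S) ^ (⌈((a + b : ℕ) : ℚ) * (n : ℚ)⌉₊ - ⌈(b : ℚ) * (n : ℚ)⌉₊)) *
      (Ideal.span ({x, y} : Set S) ^ (⌊((a + b : ℕ) : ℚ) * (n' : ℚ)⌋₊ + 1) ⊔
        Ideal.span {y ^ ⌈(b : ℚ) * (n' : ℚ)⌉₊} *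
          Ideal.span ({x, y} : Set S) ^ (⌈((a + b : ℕ) : ℚ) * (n' : ℚ)⌉₊ - ⌈(b : ℚ) * (n' : ℚ)⌉₊)) ≤
      Ideal.span ({x, y} : Set S) ^ (⌊((a + b : ℕ) : ℚ) * ((n + n' : ℕ) : ℚ)⌋₊ + 1) ⊔
        Ideal.span {y ^ ⌈(b : ℚ) * ((n + n' : ℕ) : ℚ)⌉₊} *
          Ideal.span ({x, y} : Set S) ^ (⌈((a + b : ℕ) : ℚ) * ((n + n' : ℕ) : ℚ)⌉₊ - ⌈(b : ℚ) * ((n + n' : ℕ) : ℚ)⌉₊) := by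
  rw [faceCell_eq, faceCell_eq, faceCell_eq]
  set P : Ideal S := Ideal.span ({x, y} : Set S) with hP
  have hyP : ∀ e : ℕ, Ideal.span {y ^ e} ≤ P ^ e := fun e => by
    rw [Ideal.span_singleton_le_iff_mem]
    exact Ideal.pow_mem_pow (Ideal.subset_span (by simp)) e
  rw [Ideal.sup_mul, Ideal.mul_sup, Ideal.mul_sup]
  refine sup_le (sup_le ?_ ?_) (sup_le ?_ ?_)
  · -- `P^((a+b)n+1) · P^((a+b)n'+1)`
    rw [← pow_add]
    exact le_sup_of_le_left (Ideal.pow_le_pow_right (by nlinarith))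
  · -- `P^((a+b)n+1) · (y^(bn') P^(an'))`
    refine le_sup_of_le_left ?_
    calc P ^ ((a + b) * n + 1) * (Ideal.span {y ^ (b * n')} * P ^ (a * n'))
        ≤ P ^ ((a + b) * n + 1) * (P ^ (b * n') * P ^ (a * n')) :=
          Ideal.mul_mono_right (Ideal.mul_mono_left (hyP _))
      _ = P ^ ((a + b) * n + 1 + b * n' + a * n') := by rw [← pow_add, ← pow_add, ← add_assoc]
      _ ≤ P ^ ((a + b) * (n + n') + 1) := Ideal.pow_le_pow_right (by nlinarith)
  · -- `(y^(bn) P^(an)) · P^((a+b)n'+1)`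
    refine le_sup_of_le_left ?_
    calc Ideal.span {y ^ (b * n)} * P ^ (a * n) * P ^ ((a + b) * n' + 1)
        ≤ P ^ (b * n) * P ^ (a * n) * P ^ ((a + b) * n' + 1) :=
          Ideal.mul_mono_left (Ideal.mul_mono_left (hyP _))
      _ = P ^ (b * n + a * n + ((a + b) * n' + 1)) := by rw [← pow_add, ← pow_add]
      _ ≤ P ^ ((a + b) * (n + n') + 1) := Ideal.pow_le_pow_right (by nlinarith)
  · -- `(y^(bn) P^(an)) · (y^(bn') P^(an'))`
    refine le_sup_of_le_right ?_
    calc Ideal.span {y ^ (b * n)} * P ^ (a * n) * (Ideal.span {y ^ (b * n')} * P ^ (a * n'))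
        = (Ideal.span {y ^ (b * n)} * Ideal.span {y ^ (b * n')}) * (P ^ (a * n) * P ^ (a * n')) := by ring
      _ ≤ Ideal.span {y ^ (b * (n + n'))} * P ^ (a * (n + n')) := by
          rw [Ideal.span_singleton_mul_span_singleton, ← pow_add, ← pow_add, ← Nat.mul_add, ← Nat.mul_add]

/-- The face-end monomial `λ · x^a y^b` lies in the first face cell `C(1)`. [folklore] -/
theorem monomial_mem_faceCell_one (x y : S) (a b : ℕ) (c : S) :
    c * x ^ a * y ^ b ∈ Ideal.span ({x, y} : Set S) ^ (⌊((a + b : ℕ) : ℚ) * ((1 : ℕ) : ℚ)⌋₊ + 1) ⊔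
        Ideal.span {y ^ ⌈(b : ℚ) * ((1 : ℕ) : ℚ)⌉₊} *
          Ideal.span ({x, y} : Set S) ^ (⌈((a + b : ℕ) : ℚ) * ((1 : ℕ) : ℚ)⌉₊ - ⌈(b : ℚ) * ((1 : ℕ) : ℚ)⌉₊) := by
  rw [faceCell_eq, mul_one, mul_one, mul_one]
  refine Ideal.mem_sup_right ?_
  rw [show c * x ^ a * y ^ b = y ^ b * (c * x ^ a) by ring]
  refine Ideal.mul_mem_mul (Ideal.mem_span_singleton_self _) (Ideal.mul_mem_left _ _ ?_)
  exact Ideal.pow_mem_pow (Ideal.subset_span (by simp)) a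

/-- **`DeltaFaceGe` is invariant under integral face moves.** For the integral face end `(a, b)` (`δ = a + b`, `γ = b`) and any
`l₁, l₂`: `DeltaFaceGe x y (z + l₁ x^a y^b) (w + l₂ x^a y^b) d (a + b) b f ↔ DeltaFaceGe x y z w d (a + b) b f`.
[cite: CossartJannsenSaito2020, Lemma 12.1 (4)] -/
theorem deltaFaceGe_faceMove_iff (x y z w : S) (a b : ℕ) (l₁ l₂ : S) (d : ℕ) (f : S) :
    DeltaFaceGe x y (z + l₁ * x ^ a * y ^ b) (w + l₂ * x ^ a * y ^ b) d ((a : ℚ) + b) b f ↔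
      DeltaFaceGe x y z w d ((a : ℚ) + b) b f := by
  have hcast : ((a : ℚ) + b) = ((a + b : ℕ) : ℚ) := by push_cast; ring
  unfold DeltaFaceGe
  rw [hcast]
  have key := sup_iSup_eq_of_move
    (C := fun n : ℕ => Ideal.span ({x, y} : Set S) ^ (⌊((a + b : ℕ) : ℚ) * (n : ℚ)⌋₊ + 1) ⊔
      Ideal.span {y ^ ⌈(b : ℚ) * (n : ℚ)⌉₊} *
        Ideal.span ({x, y} : Set S) ^ (⌈((a + b : ℕ) : ℚ) * (n : ℚ)⌉₊ - ⌈(b : ℚ) * (n : ℚ)⌉₊))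
    (faceCell_zero x y a b) (fun n n' => faceCell_mul_le x y a b n n') z w
    (monomial_mem_faceCell_one x y a b l₁) (monomial_mem_faceCell_one x y a b l₂) d
  rw [key]

end Summit.ResolutionOfSingularities.ResolutionOfSingularities.Theorems.SwitchingDichotomy.BetaNewton

end
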